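import Literature.AlgebraicGeometry.Resolution.LogRegularPlacementCharts
import Literature.AlgebraicGeometry.Resolution.LogRegularEtaleLocal
import Mathlib.AlgebraicGeometry.Morphisms.Etale
import HarnessLib

/-!
# Affine étale pieces of a log regular scheme and their placement atlases
# (ÉTALE KATO programme, block EK-3a)

Topic: `Literature/AlgebraicGeometry/Resolution`. Nizioł 2006 §2: a log regular scheme with fs
charts on the ÉTALE site. For the resolution by one blowing up (Kato 1994 (10.4) on étale charts,
Nizioł Cor. 5.7) one works with finitely many AFFINE étale pieces `e_k : V_k → X` carrying charts
`φ_k : P_{idx k} → Γ(V_k, 𝒪)` of a model family (`LogRegularAtlas.Model`), log regular at every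
prime, and defining the same log structure on the fibre products `V_k ×_X V_{k'}` — the structure
`LogRegularAtlas.EtalePieces` of this file (produced from an `EtaleLogAtlas` in block EK-0). The
chart step (`Placements.exists_compatible_regular_charts`, block EK-2) is applied to the family of
PLACEMENT ATLASES attached to the pieces:

* `EtalePieces.single k` — the one-chart atlas of `V_k`;
* `EtalePieces.pair k k'` — the atlas of `V_k ×_X V_{k'}` by the two pulled-back charts
  `pr₁^* φ_k`, `pr₂^* φ_{k'}` restricted to a finite affine cover (log regular because `pr₁, pr₂`
  are étale, `LogChart.isLogRegularLocal_comp_stalkMap_iff`, EK-1; compatible by hypothesis).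

Also: the translation between Kato's (2.1) at the primes of an affine open and at the stalks of
its points (`LogChart.isLogRegularAt_primeIdealOf_iff`), and the stalk monoid of a pulled-back
chart along a morphism with LOCAL stalk maps (`chartStalkMonoid_appLE_eq`).

References: [Niziol2006] §2.1–2.2, Lemma 2.3; [Kato1994] (1.5), (1.8), Def. (2.1), (10.1).
-/

noncomputable section

open AlgebraicGeometry CategoryTheory CategoryTheory.Limits TopologicalSpace Opposite

namespace Literature.AlgebraicGeometry.Resolution

universe u

/-! ## Kato's (2.1): primes of an affine open vs stalks -/

section AffineStalk

variable {Y : Scheme.{u}}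

/-- On an affine open, every prime ideal of the ring of sections is the prime of a point.
[folklore] -/
private theorem exists_primeIdealOf_eq'' {V : Y.Opens} (hV : IsAffineOpen V) (𝔭 : Ideal Γ(Y, V))
    [𝔭.IsPrime] : ∃ y : V, hV.primeIdealOf y = ⟨𝔭, inferInstance⟩ :=
  ⟨⟨hV.fromSpec ⟨𝔭, inferInstance⟩, hV.range_fromSpec.le ⟨_, rfl⟩⟩, by
    apply hV.fromSpec.isOpenEmbedding.injective
    rw [hV.fromSpec_primeIdealOf]⟩

/-- **Kato's (2.1) at the prime of a point of an affine open is (2.1) for the stalk chart**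
(`𝒪_{Y,y} ≅ Γ(Y, V)_{𝔭_y}`, `LogChart.isLogRegularAt_iff_isLogRegularLocal`,
`LogChart.isLogRegularLocal_comp_equiv`). [cite: Kato1994, Def. (2.1)] -/
theorem LogChart.isLogRegularAt_primeIdealOf_iff {V : Y.Opens} (hV : IsAffineOpen V) {n : ℕ}
    (P : AddSubmonoid (Fin n → ℤ)) (φ : Multiplicative P →* Γ(Y, V)) (y : Y) (hy : y ∈ V) :
    LogChart.IsLogRegularAt P φ (hV.primeIdealOf ⟨y, hy⟩).asIdeal ↔
      LogChart.IsLogRegularLocal P ((Y.presheaf.germ V y hy).hom.toMonoidHom.comp φ) := by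
  letI alg : Algebra Γ(Y, V) (Y.presheaf.stalk y) := (Y.presheaf.germ V y hy).hom.toAlgebra
  haveI : IsLocalization.AtPrime (Y.presheaf.stalk y) (hV.primeIdealOf ⟨y, hy⟩).asIdeal :=
    hV.isLocalization_stalk ⟨y, hy⟩
  let e : Localization.AtPrime (hV.primeIdealOf ⟨y, hy⟩).asIdeal ≃ₐ[Γ(Y, V)]
      (Y.presheaf.stalk y : Type u) :=
    IsLocalization.algEquiv (hV.primeIdealOf ⟨y, hy⟩).asIdeal.primeCompl _ _
  rw [LogChart.isLogRegularAt_iff_isLogRegularLocal,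
    ← LogChart.isLogRegularLocal_comp_equiv _ _ e.toRingEquiv]
  have hcharts : e.toRingEquiv.toMonoidHom.comp
      ((algebraMap Γ(Y, V)
        (Localization.AtPrime (hV.primeIdealOf ⟨y, hy⟩).asIdeal)).toMonoidHom.comp φ) =
      (Y.presheaf.germ V y hy).hom.toMonoidHom.comp φ := by
    refine MonoidHom.ext fun p => ?_
    change e (algebraMap Γ(Y, V) _ (φ p)) = (Y.presheaf.germ V y hy).hom (φ p)
    rw [AlgEquiv.commutes]
    rfl
  rw [hcharts]

/-- **Stalk monoid of a chart pulled back along a morphism with local stalk maps** (`f^* φ`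
restricted to an open `W ⊆ f⁻¹ V`): it is generated by the units of `𝒪_{Y',y}` and the image of
the stalk monoid of `φ` at `f y` (germs: `(f^* s)_y = f_y^*(s_{f y})`).
[cite: Kato1994, (1.5)–(1.6)] -/
theorem chartStalkMonoid_appLE_eq {Y' : Scheme.{u}} (f : Y' ⟶ Y) (V : Y.Opens) (W : Y'.Opens)
    (hle : W ≤ f ⁻¹ᵁ V) {P : Type*} [MulOneClass P] (φ : P →* Γ(Y, V)) (y : Y') (hy : y ∈ W) :
    chartStalkMonoid W ((f.appLE V W hle).hom.toMonoidHom.comp φ) y hy =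
      IsUnit.submonoid (Y'.presheaf.stalk y) ⊔
        (chartStalkMonoid V φ (f.base y) (hle hy)).map (f.stalkMap y).hom.toMonoidHom := by
  rw [chartStalkMonoid, chartStalkMonoid, Submonoid.map_sup, ← sup_assoc]
  have hu : IsUnit.submonoid (Y'.presheaf.stalk y) ⊔
      (IsUnit.submonoid (Y.presheaf.stalk (f.base y))).map (f.stalkMap y).hom.toMonoidHom =
      IsUnit.submonoid (Y'.presheaf.stalk y) := by
    refine sup_eq_left.2 ?_
    rintro _ ⟨a, ha, rfl⟩
    exact (IsUnit.mem_submonoid_iff _).2 (((IsUnit.mem_submonoid_iff _).1 ha).map _)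
  rw [hu, Submonoid.map_map, MonoidHom.map_mrange, MonoidHom.map_mrange]
  congr 1
  refine congrArg MonoidHom.mrange (MonoidHom.ext fun p => ?_)
  simp only [MonoidHom.coe_comp, Function.comp_apply, RingHom.toMonoidHom_eq_coe,
    MonoidHom.coe_coe]
  rw [Scheme.Hom.germ_stalkMap_apply, Scheme.Hom.appLE, CommRingCat.comp_apply,
    TopCat.Presheaf.germ_res_apply]

/-- Germs of `f^*` of a section: `(f^{*}_{V,W} s)_y = f_y^* (s_{f y})`. [folklore] -/
private theorem germ_appLE_eq' {Y' : Scheme.{u}} (f : Y' ⟶ Y) (V : Y.Opens) (W : Y'.Opens)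
    (hle : W ≤ f ⁻¹ᵁ V) (y : Y') (hy : y ∈ W) (s : Γ(Y, V)) :
    (Y'.presheaf.germ W y hy).hom (f.appLE V W hle s) =
      (f.stalkMap y).hom ((Y.presheaf.germ V (f.base y) (hle hy)).hom s) := by
  rw [Scheme.Hom.germ_stalkMap_apply, Scheme.Hom.appLE, CommRingCat.comp_apply,
    TopCat.Presheaf.germ_res_apply]

end AffineStalk

namespace LogRegularAtlas

/-! ## Affine étale pieces -/

/-- **Affine étale pieces of a log regular scheme with étale charts** (Nizioł 2006 §2.1–2.2, Kato
(1.8)): finitely many affine schemes `V_k`, étale morphisms `e_k : V_k → X` jointly surjective,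
and charts `φ_k : P_{idx k} → Γ(V_k, 𝒪)` by members of a model family `M`, log regular at every
prime of the (Noetherian) ring `Γ(V_k, 𝒪)` (Kato Def. (2.1)), defining the same log structure on
the fibre products: at every point `w` of `V_k ×_X V_{k'}` the pulled-back charts `pr₁^* φ_k`,
`pr₂^* φ_{k'}` generate the same stalk monoid. [cite: Niziol2006, §2.1–2.2]
[cite: Kato1994, (1.5), (1.8) and Def. (2.1)] -/
structure EtalePieces (X : Scheme.{u}) (M : Model) where
  /-- index type of the pieces (finite) -/
  κ : Type
  /-- finitely many pieces -/
  fintype : Fintype κ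
  /-- the pieces -/
  V : κ → Scheme.{u}
  /-- they are affine -/
  affine : ∀ k, IsAffine (V k)
  /-- the structure morphisms -/
  e : ∀ k, V k ⟶ X
  /-- étale: flat -/
  flat : ∀ k, Flat (e k)
  /-- étale: unramified -/
  unramified : ∀ k, FormallyUnramified (e k)
  /-- étale: locally of finite type -/
  lft : ∀ k, LocallyOfFiniteType (e k)
  /-- quasi-compact -/
  quasiCompact : ∀ k, QuasiCompact (e k)
  /-- jointly surjective -/
  surj : ∀ x : X, ∃ (k : κ) (v : V k), (e k).base v = x
  /-- the model member of the `k`-th chart -/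
  idx : κ → M.ι
  /-- Noetherian section rings -/
  isNoetherianRing : ∀ k, IsNoetherianRing Γ(V k, ⊤)
  /-- the charts -/
  φ : ∀ k, Multiplicative (M.P (idx k)) →* Γ(V k, ⊤)
  /-- log regular at every prime -/
  isLogRegularAt : ∀ k (𝔭 : Ideal Γ(V k, ⊤)) [𝔭.IsPrime],
    LogChart.IsLogRegularAt (M.P (idx k)) (φ k) 𝔭
  /-- the same log structure on the fibre products: at every point `w` of `V_k ×_X V_{k'}` the
  stalk monoids of `φ_k` at `pr₁ w` and of `φ_{k'}` at `pr₂ w` generate, with the units, the same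
  submonoid of `𝒪_w` -/
  compat : ∀ (k k' : κ) (w : ↑(pullback (e k) (e k'))),
    IsUnit.submonoid ((pullback (e k) (e k')).presheaf.stalk w) ⊔
        (chartStalkMonoid ⊤ (φ k) ((pullback.fst (e k) (e k')).base w) trivial).map
          ((pullback.fst (e k) (e k')).stalkMap w).hom.toMonoidHom =
      IsUnit.submonoid ((pullback (e k) (e k')).presheaf.stalk w) ⊔
        (chartStalkMonoid ⊤ (φ k') ((pullback.snd (e k) (e k')).base w) trivial).map
          ((pullback.snd (e k) (e k')).stalkMap w).hom.toMonoidHom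

namespace EtalePieces

variable {X : Scheme.{u}} {M : Model} (E : EtalePieces X M)

-- The class-valued FIELDS of the structure (data of the pieces, no library instance is overridden).
attribute [instance] EtalePieces.fintype EtalePieces.affine EtalePieces.flat
  EtalePieces.unramified EtalePieces.lft EtalePieces.quasiCompact

/-- The pieces are locally Noetherian: an affine scheme whose coordinate ring is Noetherian is
(locally) Noetherian. [cite: Hartshorne1977, Prop. II.3.2] -/
instance isLocallyNoetherian (k : E.κ) : IsLocallyNoetherian (E.V k) :=
  isLocallyNoetherian_of_affine_cover (ι := Unit) (S := fun _ => ⟨⊤, isAffineOpen_top _⟩)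
    (by simp) (fun _ => E.isNoetherianRing k)

/-! ### The one-chart atlas of a piece -/

/-- **The one-chart placement atlas of the piece `V_k`.** [cite: Kato1994, (1.5) and Def. (2.1)] -/
def single (k : E.κ) : Placements (E.V k) M where
  κ := Unit
  finite := inferInstance
  idx _ := E.idx k
  U _ := ⟨⊤, isAffineOpen_top _⟩
  iSup_eq_top := by simp
  isNoetherianRing _ := E.isNoetherianRing k
  φ _ := E.φ k
  isLogRegularAt _ 𝔭 _ := E.isLogRegularAt k 𝔭
  compat _ _ x hk hl := rfl

/-! ### The two-chart atlas of a fibre product of pieces -/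

/-- The fibre product of two pieces. [folklore] -/
abbrev PB (k k' : E.κ) : Scheme.{u} := pullback (E.e k) (E.e k')

/-- A finite affine open cover of `V_k ×_X V_{k'}` (quasi-compact: `V_k` affine, `e_{k'}`
quasi-compact). [folklore] -/
private theorem exists_cover (k k' : E.κ) :
    ∃ (m : ℕ) (W : Fin m → (pullback (E.e k) (E.e k')).affineOpens),
      ⨆ t, (W t : (pullback (E.e k) (E.e k')).Opens) = ⊤ :=
  exists_finite_affine_cover _

/-- The size of the chosen affine cover of `V_k ×_X V_{k'}`. [folklore] -/
def coverSize (k k' : E.κ) : ℕ := (E.exists_cover k k').choose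

/-- The chosen affine cover of `V_k ×_X V_{k'}`. [folklore] -/
def cover (k k' : E.κ) : Fin (E.coverSize k k') → (pullback (E.e k) (E.e k')).affineOpens :=
  (E.exists_cover k k').choose_spec.choose

/-- The chosen affine opens cover. [folklore] -/
private theorem iSup_cover (k k' : E.κ) :
    ⨆ t, (E.cover k k' t : (pullback (E.e k) (E.e k')).Opens) = ⊤ :=
  (E.exists_cover k k').choose_spec.choose_spec

/-- The model member of the chart `b` of the pair: `idx k` (`b = false`, first projection) or
`idx k'` (`b = true`, second projection). [cite: Kato1994, (10.1)] -/
@[reducible] def pairIdx (k k' : E.κ) (b : Bool) : M.ι := cond b (E.idx k') (E.idx k)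

/-- The pulled-back chart on an affine open `W` of `V_k ×_X V_{k'}`: `pr₁^* φ_k` (`b = false`) or
`pr₂^* φ_{k'}` (`b = true`), restricted to `W`. [cite: Kato1994, (10.1)] -/
def pairChart (k k' : E.κ) (W : (E.PB k k').affineOpens) :
    (b : Bool) → Multiplicative (M.P (E.pairIdx k k' b)) →*
      Γ(E.PB k k', (W : (E.PB k k').Opens))
  | false => ((pullback.fst (E.e k) (E.e k')).appLE ⊤ W le_top).hom.toMonoidHom.comp (E.φ k)
  | true => ((pullback.snd (E.e k) (E.e k')).appLE ⊤ W le_top).hom.toMonoidHom.comp (E.φ k')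

/-- The stalk monoid of either pulled-back chart at `w` is the common one of `compat`.
[cite: Kato1994, (1.5)–(1.6)] -/
theorem chartStalkMonoid_pairChart (k k' : E.κ) (W : (E.PB k k').affineOpens)
    (b : Bool) (w : ↑(E.PB k k')) (hw : w ∈ (W : (E.PB k k').Opens)) :
    chartStalkMonoid (W : (E.PB k k').Opens) (E.pairChart k k' W b) w hw =
      IsUnit.submonoid ((E.PB k k').presheaf.stalk w) ⊔
        (chartStalkMonoid ⊤ (E.φ k) ((pullback.fst (E.e k) (E.e k')).base w) trivial).map
          ((pullback.fst (E.e k) (E.e k')).stalkMap w).hom.toMonoidHom := by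
  cases b
  · rw [pairChart, chartStalkMonoid_appLE_eq]
    rfl
  · rw [pairChart, chartStalkMonoid_appLE_eq, E.compat k k' w]
    rfl

/-- Log regularity of the pulled-back charts at the primes of `Γ(V_k ×_X V_{k'}, W)` (pass to the
point, then along the étale `pr₁`/`pr₂` by `LogChart.isLogRegularLocal_comp_stalkMap_iff`).
[cite: Niziol2006, Lemma 2.3] [cite: Kato1994, Def. (2.1)] -/
theorem isLogRegularAt_pairChart (k k' : E.κ) (W : (E.PB k k').affineOpens)
    (b : Bool) (𝔭 : Ideal Γ(E.PB k k', (W : (E.PB k k').Opens))) [𝔭.IsPrime] :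
    LogChart.IsLogRegularAt (M.P (E.pairIdx k k' b)) (E.pairChart k k' W b) 𝔭 := by
  obtain ⟨⟨w, hw⟩, hy⟩ := exists_primeIdealOf_eq'' W.2 𝔭
  cases b
  · change LogChart.IsLogRegularAt (M.P (E.idx k))
      (((pullback.fst (E.e k) (E.e k')).appLE ⊤ W le_top).hom.toMonoidHom.comp (E.φ k)) 𝔭
    have key : LogChart.IsLogRegularAt (M.P (E.idx k))
        (((pullback.fst (E.e k) (E.e k')).appLE ⊤ W le_top).hom.toMonoidHom.comp (E.φ k))
        (W.2.primeIdealOf ⟨w, hw⟩).asIdeal := by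
      rw [LogChart.isLogRegularAt_primeIdealOf_iff]
      have hc : ((E.PB k k').presheaf.germ (W : (E.PB k k').Opens) w hw).hom.toMonoidHom.comp
          ((((pullback.fst (E.e k) (E.e k')).appLE ⊤ W le_top).hom.toMonoidHom.comp (E.φ k))) =
          ((pullback.fst (E.e k) (E.e k')).stalkMap w).hom.toMonoidHom.comp
            (((E.V k).presheaf.germ ⊤ _ trivial).hom.toMonoidHom.comp (E.φ k)) :=
        MonoidHom.ext fun p =>
          germ_appLE_eq' (pullback.fst (E.e k) (E.e k')) ⊤ W le_top w hw (E.φ k p)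
      rw [hc]
      haveI : FormallyUnramified (pullback.fst (E.e k) (E.e k')) :=
        MorphismProperty.pullback_fst _ _ inferInstance
      exact (LogChart.isLogRegularLocal_comp_stalkMap_iff (pullback.fst (E.e k) (E.e k')) w
        (M.P (E.idx k)) _).2 ((LogChart.isLogRegularAt_primeIdealOf_iff (isAffineOpen_top (E.V k))
          _ _ _ _).1 (E.isLogRegularAt k _))
    rw [hy] at key
    exact key
  · change LogChart.IsLogRegularAt (M.P (E.idx k'))
      (((pullback.snd (E.e k) (E.e k')).appLE ⊤ W le_top).hom.toMonoidHom.comp (E.φ k')) 𝔭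
    have key : LogChart.IsLogRegularAt (M.P (E.idx k'))
        (((pullback.snd (E.e k) (E.e k')).appLE ⊤ W le_top).hom.toMonoidHom.comp (E.φ k'))
        (W.2.primeIdealOf ⟨w, hw⟩).asIdeal := by
      rw [LogChart.isLogRegularAt_primeIdealOf_iff]
      have hc : ((E.PB k k').presheaf.germ (W : (E.PB k k').Opens) w hw).hom.toMonoidHom.comp
          ((((pullback.snd (E.e k) (E.e k')).appLE ⊤ W le_top).hom.toMonoidHom.comp (E.φ k'))) =
          ((pullback.snd (E.e k) (E.e k')).stalkMap w).hom.toMonoidHom.comp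
            (((E.V k').presheaf.germ ⊤ _ trivial).hom.toMonoidHom.comp (E.φ k')) :=
        MonoidHom.ext fun p =>
          germ_appLE_eq' (pullback.snd (E.e k) (E.e k')) ⊤ W le_top w hw (E.φ k' p)
      rw [hc]
      haveI : FormallyUnramified (pullback.snd (E.e k) (E.e k')) :=
        MorphismProperty.pullback_snd _ _ inferInstance
      exact (LogChart.isLogRegularLocal_comp_stalkMap_iff (pullback.snd (E.e k) (E.e k')) w
        (M.P (E.idx k')) _).2 ((LogChart.isLogRegularAt_primeIdealOf_iff (isAffineOpen_top (E.V k'))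
          _ _ _ _).1 (E.isLogRegularAt k' _))
    rw [hy] at key
    exact key

/-- **The two-chart placement atlas of `V_k ×_X V_{k'}`** on the chosen finite affine cover:
charts `pr₁^* φ_k|_{W_t}` and `pr₂^* φ_{k'}|_{W_t}`. [cite: Kato1994, (1.5), (10.1)] -/
def pair (k k' : E.κ) : Placements (pullback (E.e k) (E.e k')) M where
  κ := Fin (E.coverSize k k') × Bool
  finite := inferInstance
  idx tb := E.pairIdx k k' tb.2
  U tb := E.cover k k' tb.1
  iSup_eq_top := by
    apply top_le_iff.mp
    rw [← E.iSup_cover k k']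
    exact iSup_le fun t => le_iSup (fun tb : Fin (E.coverSize k k') × Bool =>
      (E.cover k k' tb.1 : (pullback (E.e k) (E.e k')).Opens)) (t, false)
  isNoetherianRing tb := IsLocallyNoetherian.component_noetherian _
  φ tb := E.pairChart k k' (E.cover k k' tb.1) tb.2
  isLogRegularAt tb 𝔭 _ := E.isLogRegularAt_pairChart k k' _ tb.2 𝔭
  compat tb tb' w h h' := by
    rw [chartStalkMonoid_pairChart, chartStalkMonoid_pairChart]

end EtalePieces

end LogRegularAtlas

end Literature.AlgebraicGeometry.Resolution

end
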